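import Literature.NumberTheory.GaloisRepresentations.ShapiroVanishing
import Mathlib.Topology.Algebra.OpenSubgroup
import HarnessLib

/-!
# Vanishing descends from an open subgroup of index prime to `p` (Serre I §2.4–2.5, §3.3)

Serre, *Cohomologie galoisienne*, I §3.3, proof of Prop. 14 and Cor. 1 ("`cd_p(G) = cd_p(G_p)`"):
restriction to a subgroup of index prime to `p` is injective on `p`-primary components, because
`Cor ∘ Res` is multiplication by the index (I §2.4 Prop. 9).  This file proves the resulting
**transfer of vanishing** for Mathlib's continuous cohomology without a corestriction map, for an
*open* subgroup `S` of a profinite group `G` and a discrete `G`-module `M` on which the index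
`(G : S)` acts bijectively (e.g. `M` `p`-primary torsion and `p ∤ (G : S)`,
`bijective_nsmul_of_isPrimaryTorsion`):

* `unitCoind ρ : M → M_G^S(M)`, `a ↦ (x ↦ x a)`, and `normCoind ρ : M_G^S(M) → M`,
  `a* ↦ Σ_{y S ∈ G/S} y · a*(y⁻¹)` are morphisms of discrete `G`-modules with
  `normCoind ∘ unitCoind = (G : S)` (`normCoind_unitCoind`; Serre I §2.5: the maps
  `A → M_G^H(A)` and `M_G^H(A) → A` inducing `Res` and `Cor` through the Faddeev–Shapiro
  isomorphism, I §2.4 Prop. 9 `Cor ∘ Res = n`);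
* hence, when `(G : S)` is bijective on `M`, `M` is a retract of `M_G^S(M)` and
  `H^q(G, M_G^S(M)) = 0 ⇒ H^q(G, M) = 0` (`subsingleton_of_subsingleton_coindRep`, by
  functoriality `ContinuousCohomology.map_comp`, `map_id` only);
* with Shapiro's lemma in vanishing form (`subsingleton_coindRep_of_subsingleton`,
  `ShapiroVanishing.lean`): **`H^{n+1}(S, M) = 0 ⇒ H^{n+1}(G, M) = 0`**
  (`subsingleton_of_isOpen_of_bijective`, `subsingleton_of_isOpen_of_index_coprime`).

This is step (3d) of the proof of Serre II §3.1 Prop. 5 for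
`Literature.NumberTheory.GaloisRepresentations.tsen_fieldCdLE_one_of_trdeg_eq_one`: it replaces
the passage to a `p`-Sylow subgroup by the passage to the (open) preimage of a `p`-Sylow subgroup
of a finite quotient.

## References

* J.-P. Serre, *Cohomologie galoisienne*, 5e éd., LNM 5 (1994) / *Galois Cohomology* (1997),
  I §2.4 Prop. 9 (`Cor ∘ Res = n`), I §2.5 (induced modules, Prop. 10), I §3.3 Prop. 14 and
  Cor. 1. [SerreGaloisCohomology1997]
* S. S. Shatz, *Profinite groups, arithmetic, and geometry* (1972), Ch. II §2 Thm. 8, Ch. II §4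
  (restriction and transfer). [Shatz1972]
-/

noncomputable section

open CategoryTheory Topology Set

universe u

namespace Literature.NumberTheory.GaloisRepresentations

open _root_.TopRep _root_.ContRepresentation _root_.ContinuousCohomology

/-! ### `p`-primary torsion groups: multiplication by `m` prime to `p` is bijective -/

/-- On a `p`-primary torsion abelian group, multiplication by a natural number `m` prime to `p`
is bijective (Bezout: `a m + b p^r = 1` acts as `a m` on an element killed by `p^r`).
[folklore] -/
theorem bijective_nsmul_of_isPrimaryTorsion {p m : ℕ} {M : Type*} [AddCommGroup M]
    (hM : IsPrimaryTorsion p M) (hmp : m.Coprime p) : Function.Bijective fun x : M => m • x := by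
  -- Bezout: every `x` satisfies `x = A • (m • x)` for some integer `A`
  have key : ∀ x : M, ∃ A : ℤ, x = A • (m • x) := fun x => by
    obtain ⟨r, hr⟩ := hM x
    have h1 : ((m : ℤ) * Nat.gcdA m (p ^ r) + ((p ^ r : ℕ) : ℤ) * Nat.gcdB m (p ^ r)) = 1 := by
      rw [← Nat.gcd_eq_gcd_ab, (Nat.Coprime.pow_right r hmp).gcd_eq_one, Nat.cast_one]
    refine ⟨Nat.gcdA m (p ^ r), ?_⟩
    calc x = (1 : ℤ) • x := (one_zsmul x).symm
      _ = ((m : ℤ) * Nat.gcdA m (p ^ r) + ((p ^ r : ℕ) : ℤ) * Nat.gcdB m (p ^ r)) • x := by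
          rw [h1]
      _ = Nat.gcdA m (p ^ r) • ((m : ℤ) • x) + Nat.gcdB m (p ^ r) • (((p ^ r : ℕ) : ℤ) • x) := by
          rw [add_smul, mul_comm (m : ℤ), mul_smul, mul_comm ((p ^ r : ℕ) : ℤ), mul_smul]
      _ = Nat.gcdA m (p ^ r) • (m • x) := by
          rw [natCast_zsmul, natCast_zsmul, hr, smul_zero, add_zero]
  constructor
  · intro x y hxy
    obtain ⟨A, hA⟩ := key (x - y)
    have h0 : m • (x - y) = 0 := by
      have hxy' : m • x = m • y := hxy
      rw [smul_sub, hxy', sub_self]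
    rw [h0, smul_zero] at hA
    exact sub_eq_zero.1 hA
  · intro x
    obtain ⟨A, hA⟩ := key x
    exact ⟨A • x, by
      change m • (A • x) = x
      rw [smul_comm]
      exact hA.symm⟩

/-! ### The unit `M → M_G^S(M)` and the norm `M_G^S(M) → M` -/

section UnitNorm

variable {G : Type u} [Group G] [TopologicalSpace G] [IsTopologicalGroup G] [CompactSpace G]
variable {S : Subgroup G}
variable {M : Type u} [AddCommGroup M] [TopologicalSpace M] [DiscreteTopology M]
variable (ρ : ContinuousRep G ℤ M)

/-- The unit `a ↦ (x ↦ x a)` on one element: `x ↦ ρ(x) a` lies in `M_G^S(M|_S)`. [cite: SerreGaloisCohomology1997, I §2.5] -/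
def unitCoindFun (a : M) : coindModule (ρ.restrict (subgroupIncl S)) :=
  ⟨⟨fun x => ρ x a, ρ.continuous_apply_left a⟩, fun s x => by
    change ρ ((s : G) * x) a = ρ (subgroupIncl S s) (ρ x a)
    rw [subgroupIncl_apply, map_mul, Module.End.mul_apply]⟩

omit [IsTopologicalGroup G] [CompactSpace G] in
/-- Unfolding `unitCoindFun`. [folklore] -/
@[simp] theorem unitCoindFun_coe_apply (a : M) (x : G) :
    ((unitCoindFun ρ a : coindModule (ρ.restrict (subgroupIncl S))) : C(G, M)) x = ρ x a := rfl

/-- **The unit `M → M_G^S(M)`**, `a ↦ (x ↦ x a)`, a morphism of discrete `G`-modules (it induces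
the restriction `H^q(G, M) → H^q(S, M)` through the Faddeev–Shapiro isomorphism, Serre I §2.5).
[cite: SerreGaloisCohomology1997, I §2.5] -/
def unitCoind : ρ.toTopRep ⟶ (coindRep (ρ.restrict (subgroupIncl S))).toTopRep :=
  TopRep.ofHom
    { toLinearMap :=
        { toFun := unitCoindFun ρ
          map_add' := fun a b => Subtype.ext (ContinuousMap.ext fun x => map_add (ρ x) a b)
          map_smul' := fun c a => Subtype.ext (ContinuousMap.ext fun x => map_zsmul (ρ x) c a) }
      cont := continuous_of_discreteTopology
      isIntertwining' := fun g => by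
        ext a x
        change ρ x (ρ g a) = ρ (x * g) a
        rw [map_mul, Module.End.mul_apply] }

/-- `unitCoind` on elements. [folklore] -/
@[simp] theorem unitCoind_hom_coe_apply (a : M) (x : G) :
    (((unitCoind (S := S) ρ).hom a : coindModule (ρ.restrict (subgroupIncl S))) : C(G, M)) x =
      ρ x a := rfl

/-- The summand `y ↦ y · a*(y⁻¹)` of the norm; it is constant on left cosets `y S`. [folklore] -/
def normTerm (F : coindModule (ρ.restrict (subgroupIncl S))) (y : G) : M :=
  ρ y ((F : C(G, M)) y⁻¹)

omit [IsTopologicalGroup G] [CompactSpace G] in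
/-- `normTerm F (y s) = normTerm F y` for `s ∈ S` (`a*(s⁻¹ y⁻¹) = s⁻¹ a*(y⁻¹)`). [folklore] -/
theorem normTerm_mul_of_mem (F : coindModule (ρ.restrict (subgroupIncl S))) (y : G) {s : G}
    (hs : s ∈ S) : normTerm ρ F (y * s) = normTerm ρ F y := by
  unfold normTerm
  have h := (mem_coind_iff (ρ.restrict (subgroupIncl S)) _).1 F.2 ⟨s⁻¹, S.inv_mem hs⟩ y⁻¹
  change (F : C(G, M)) (s⁻¹ * y⁻¹) = ρ (s⁻¹) ((F : C(G, M)) y⁻¹) at h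
  rw [mul_inv_rev, h, ← Module.End.mul_apply, ← map_mul, mul_assoc, mul_inv_cancel, mul_one]

omit [IsTopologicalGroup G] [CompactSpace G] in
/-- `normTerm F` depends only on the left coset `y S`. [folklore] -/
theorem normTerm_eq_of_coe_eq (F : coindModule (ρ.restrict (subgroupIncl S))) {a b : G}
    (h : (a : G ⧸ S) = b) : normTerm ρ F a = normTerm ρ F b := by
  have hab : a⁻¹ * b ∈ S := QuotientGroup.eq.1 h
  have : b = a * (a⁻¹ * b) := by rw [mul_inv_cancel_left]
  rw [this, normTerm_mul_of_mem ρ F a hab]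

variable [Fintype (G ⧸ S)]

/-- The norm on one element: `a* ↦ Σ_{c ∈ G/S} c̃ · a*(c̃⁻¹)` for representatives `c̃` of the
left cosets `c`. [cite: SerreGaloisCohomology1997, I §2.5] -/
def normCoindFun (F : coindModule (ρ.restrict (subgroupIncl S))) : M :=
  ∑ c : G ⧸ S, normTerm ρ F c.out

omit [IsTopologicalGroup G] [CompactSpace G] in
/-- The norm sum may be computed on any family of representatives obtained by translating the
chosen ones: `Σ_c normTerm F (g · c̃) = Σ_c normTerm F c̃`. [folklore] -/
theorem sum_normTerm_mul (F : coindModule (ρ.restrict (subgroupIncl S))) (g : G) :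
    ∑ c : G ⧸ S, normTerm ρ F (g * c.out) = ∑ c : G ⧸ S, normTerm ρ F c.out := by
  have h1 : ∀ c : G ⧸ S, normTerm ρ F (g * c.out) = normTerm ρ F (g • c : G ⧸ S).out := fun c =>
    normTerm_eq_of_coe_eq ρ F (by
      rw [QuotientGroup.out_eq', ← QuotientGroup.out_eq' c, MulAction.Quotient.smul_mk,
        QuotientGroup.out_eq', smul_eq_mul])
  simp_rw [h1]
  exact Fintype.sum_equiv (MulAction.toPerm g) _ _ fun c => rfl

/-- **The norm `M_G^S(M) → M`**, `a* ↦ Σ_{y S ∈ G/S} y · a*(y⁻¹)`, a morphism of discrete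
`G`-modules (it induces the corestriction through the Faddeev–Shapiro isomorphism; Serre I §2.5,
the map `M_G^H(A) → A`). [cite: SerreGaloisCohomology1997, I §2.5] -/
def normCoind : (coindRep (ρ.restrict (subgroupIncl S))).toTopRep ⟶ ρ.toTopRep :=
  TopRep.ofHom
    { toLinearMap :=
        { toFun := normCoindFun ρ
          map_add' := fun F F' => by
            unfold normCoindFun normTerm
            rw [← Finset.sum_add_distrib]
            exact Finset.sum_congr rfl fun c _ => map_add (ρ _) _ _
          map_smul' := fun a F => by
            unfold normCoindFun normTerm
            rw [RingHom.id_apply, Finset.smul_sum]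
            exact Finset.sum_congr rfl fun c _ => map_zsmul (ρ _) a _ }
      cont := by
        haveI := discreteTopology_coind (S := S) (ρ.restrict (subgroupIncl S))
        exact continuous_of_discreteTopology
      isIntertwining' := fun g => by
        ext F
        change normCoindFun ρ (coindRep _ g F) = ρ g (normCoindFun ρ F)
        unfold normCoindFun
        have h1 : ∀ c : G ⧸ S, normTerm ρ (coindRep _ g F) c.out =
            ρ g (normTerm ρ F (g⁻¹ * c.out)) := fun c => by
          unfold normTerm
          rw [coindRep_apply_apply, ← Module.End.mul_apply, ← map_mul, mul_inv_cancel_left,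
            mul_inv_rev, inv_inv]
        simp_rw [h1]
        rw [← map_sum, sum_normTerm_mul] }

/-- `normCoind` on elements. [folklore] -/
theorem normCoind_hom_apply (F : coindModule (ρ.restrict (subgroupIncl S))) :
    (normCoind ρ).hom F = ∑ c : G ⧸ S, ρ c.out ((F : C(G, M)) c.out⁻¹) := rfl

/-- **`Norm ∘ unit = (G : S)`** (Serre I §2.4 Prop. 9, `Cor ∘ Res = n`, transported to the
induced module): `Σ_c c̃ · (c̃⁻¹ a) = (G : S) a`. [cite: SerreGaloisCohomology1997, I §2.4 Prop. 9] -/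
theorem normCoind_unitCoind (a : M) :
    (normCoind ρ).hom ((unitCoind (S := S) ρ).hom a) = Fintype.card (G ⧸ S) • a := by
  rw [normCoind_hom_apply]
  have : ∀ c : G ⧸ S, ρ c.out ((((unitCoind (S := S) ρ).hom a : coindModule _) : C(G, M))
      c.out⁻¹) = a := fun c => by
    rw [unitCoind_hom_coe_apply, ← Module.End.mul_apply, ← map_mul, mul_inv_cancel, map_one,
      Module.End.one_apply]
  simp_rw [this]
  rw [Finset.sum_const, Finset.card_univ]

end UnitNorm

/-! ### `M` is a retract of `M_G^S(M)` when the index is bijective on `M` -/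

section Retract

variable {G : Type u} [Group G] [TopologicalSpace G] [IsTopologicalGroup G] [CompactSpace G]
variable {S : Subgroup G} [Fintype (G ⧸ S)]
variable {M : Type u} [AddCommGroup M] [TopologicalSpace M] [DiscreteTopology M]
variable (ρ : ContinuousRep G ℤ M) (hm : Function.Bijective fun x : M => Fintype.card (G ⧸ S) • x)

/-- Multiplication by the index as a linear automorphism of `M` (when bijective). [folklore] -/
def indexSMulEquiv : M ≃ₗ[ℤ] M :=
  LinearEquiv.ofBijective (DistribSMul.toLinearMap ℤ M (Fintype.card (G ⧸ S))) hm

omit [TopologicalSpace G] [IsTopologicalGroup G] [CompactSpace G] [TopologicalSpace M]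
  [DiscreteTopology M] in
/-- Unfolding `indexSMulEquiv`. [folklore] -/
@[simp] theorem indexSMulEquiv_apply (x : M) :
    indexSMulEquiv (S := S) hm x = Fintype.card (G ⧸ S) • x := rfl

omit [IsTopologicalGroup G] [CompactSpace G] [DiscreteTopology M] in
/-- The inverse of multiplication by the index commutes with the `G`-action. [folklore] -/
theorem indexSMulEquiv_symm_apply_rep (g : G) (x : M) :
    (indexSMulEquiv (S := S) hm).symm (ρ g x) = ρ g ((indexSMulEquiv (S := S) hm).symm x) := by
  apply (indexSMulEquiv (S := S) hm).injective
  rw [LinearEquiv.apply_symm_apply, indexSMulEquiv_apply, ← map_nsmul,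
    ← indexSMulEquiv_apply hm, LinearEquiv.apply_symm_apply]

/-- **The retraction `M_G^S(M) → M`**: the norm followed by the inverse of multiplication by
`(G : S)`; a morphism of discrete `G`-modules with `retractCoind ∘ unitCoind = id`
(`retractCoind_unitCoind`). [cite: SerreGaloisCohomology1997, I §2.4 Prop. 9 and I §2.5] -/
def retractCoind : (coindRep (ρ.restrict (subgroupIncl S))).toTopRep ⟶ ρ.toTopRep :=
  TopRep.ofHom
    { toLinearMap := ((indexSMulEquiv (S := S) hm).symm : M →ₗ[ℤ] M).comp
        (normCoind ρ).hom.toContinuousLinearMap.toLinearMap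
      cont := by
        haveI := discreteTopology_coind (S := S) (ρ.restrict (subgroupIncl S))
        exact continuous_of_discreteTopology
      isIntertwining' := fun g => by
        ext F
        change (indexSMulEquiv (S := S) hm).symm ((normCoind ρ).hom (coindRep _ g F)) =
          ρ g ((indexSMulEquiv (S := S) hm).symm ((normCoind ρ).hom F))
        rw [← indexSMulEquiv_symm_apply_rep ρ hm]
        exact congrArg _ (TopRep.hom_comm_apply (normCoind ρ) g F) }

/-- `retractCoind ∘ unitCoind = id` on elements. [cite: SerreGaloisCohomology1997, I §2.4 Prop. 9] -/
theorem retractCoind_unitCoind (a : M) :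
    (retractCoind ρ hm).hom ((unitCoind (S := S) ρ).hom a) = a := by
  change (indexSMulEquiv (S := S) hm).symm ((normCoind ρ).hom ((unitCoind (S := S) ρ).hom a)) = a
  rw [normCoind_unitCoind, ← indexSMulEquiv_apply hm, LinearEquiv.symm_apply_apply]

include hm in
/-- **`M` is a retract of `M_G^S(M)`, hence `H^q(G, M_G^S(M)) = 0 ⇒ H^q(G, M) = 0`** when the
index `(G : S)` acts bijectively on `M` (functoriality of continuous cohomology:
`H^q(retract) ∘ H^q(unit) = H^q(id) = id`). [cite: SerreGaloisCohomology1997, I §3.3 Prop. 14 Cor. 1 (proof)] -/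
theorem subsingleton_of_subsingleton_coindRep (q : ℕ)
    [h : Subsingleton (continuousCohomology q (coindRep (ρ.restrict (subgroupIncl S))).toTopRep)] :
    Subsingleton (continuousCohomology q ρ.toTopRep) := by
  let f := resIdHom (unitCoind (S := S) ρ)
  let g := resIdHom (retractCoind ρ hm)
  have hcomp : ContinuousCohomology.map (ContinuousMonoidHom.id G) f q ≫
      ContinuousCohomology.map (ContinuousMonoidHom.id G) g q = 𝟙 _ := by
    rw [← ContinuousCohomology.map_comp]
    exact map_id_eq_id _ (fun x => retractCoind_unitCoind ρ hm x) q
  have key : ∀ x, (ContinuousCohomology.map (ContinuousMonoidHom.id G) g q).hom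
      ((ContinuousCohomology.map (ContinuousMonoidHom.id G) f q).hom x) = x := fun x => by
    have hx := congr_arg (fun φ => φ.hom x) hcomp
    simpa using hx
  exact ⟨fun a b => by
    rw [← key a, ← key b, Subsingleton.elim
      ((ContinuousCohomology.map (ContinuousMonoidHom.id G) f q).hom a)
      ((ContinuousCohomology.map (ContinuousMonoidHom.id G) f q).hom b)]⟩

end Retract

/-! ### Transfer of vanishing from an open subgroup -/

section Transfer

variable {G : Type u} [Group G] [TopologicalSpace G] [IsTopologicalGroup G] [CompactSpace G]
  [T2Space G] [TotallyDisconnectedSpace G]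
variable {S : Subgroup G}
variable {M : Type u} [AddCommGroup M] [TopologicalSpace M] [DiscreteTopology M]
variable (ρ : ContinuousRep G ℤ M)

/-- **Descent of vanishing from an open subgroup** whose index acts bijectively on the module:
`H^{n+1}(S, M) = 0 ⇒ H^{n+1}(G, M)` (Shapiro's lemma in vanishing form
`subsingleton_coindRep_of_subsingleton` and the retraction `subsingleton_of_subsingleton_coindRep`).
[cite: SerreGaloisCohomology1997, I §3.3 Prop. 14 Cor. 1 (proof)] [cite: Shatz1972, Ch. II §4] -/
theorem subsingleton_of_isOpen_of_bijective (hS : IsOpen (S : Set G))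
    (hm : Function.Bijective fun x : M => S.index • x) (n : ℕ)
    (h : Subsingleton (continuousCohomology (n + 1) (ρ.restrict (subgroupIncl S)).toTopRep)) :
    Subsingleton (continuousCohomology (n + 1) ρ.toTopRep) := by
  haveI : IsClosed (S : Set G) := Subgroup.isClosed_of_isOpen S hS
  haveI : Finite (G ⧸ S) := Subgroup.quotient_finite_of_isOpen S hS
  letI : Fintype (G ⧸ S) := Fintype.ofFinite _
  have hm' : Function.Bijective fun x : M => Fintype.card (G ⧸ S) • x := by
    rwa [Subgroup.index_eq_card, Nat.card_eq_fintype_card] at hm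
  haveI := subsingleton_coindRep_of_subsingleton (G := G) n (ρ.restrict (subgroupIncl S)) h
  exact subsingleton_of_subsingleton_coindRep ρ hm' (n + 1)

/-- **Descent of vanishing from an open subgroup of index prime to `p`, for `p`-primary torsion
modules** (Serre I §3.3, Cor. 1 to Prop. 14 in vanishing form, without Sylow subgroups: "Res est
injectif sur les composantes `p`-primaires" when the index is prime to `p`):
`H^{n+1}(S, M) = 0 ⇒ H^{n+1}(G, M) = 0`. [cite: SerreGaloisCohomology1997, I §3.3 Prop. 14 and Cor. 1]
[cite: Shatz1972, Ch. II §4] -/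
theorem subsingleton_of_isOpen_of_index_coprime {p : ℕ} (hM : IsPrimaryTorsion p M)
    (hS : IsOpen (S : Set G)) (hcop : S.index.Coprime p) (n : ℕ)
    (h : Subsingleton (continuousCohomology (n + 1) (ρ.restrict (subgroupIncl S)).toTopRep)) :
    Subsingleton (continuousCohomology (n + 1) ρ.toTopRep) :=
  subsingleton_of_isOpen_of_bijective ρ hS (bijective_nsmul_of_isPrimaryTorsion hM hcop) n h

end Transfer

end Literature.NumberTheory.GaloisRepresentations

end
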